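import Mathlib

/-!
# The extreme member of the cubic family is the one with a C² downstream contact

Algebraic heart of the `w → 0` selection rule of the steady zeroth-law programme (solo-blind paper
§24.17(7)(l)).  In the sharp (Thomas–Fermi) limit the leaf-intensity profile `Q ≥ 0` of the columnar
pattern satisfies `Q‴ = 1 - s²` on its support `[a, b]` with at least double zeros at both contacts;
these profiles form the *cubic family*
`Q_{a,b}(s) = -(s-a)²(s-b)²(s+2a+2b)/60` with `3a² + 4ab + 3b² = 10`.
Feasibility of the growth-rate defect as a nonnegative measure forbids a curvature jump at the
downstream contact `b`, i.e. forces a zero of multiplicity three there.  We record: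

* `cubicFamily_normalForm`: on the family ellipse, `Q_{a,b}(s) = -s⁵/60 + s³/6 + (quadratic)`, so that
  indeed `Q‴ = 1 - s²`;
* `cubicFamily_tripleRoot_iff`: `(X - b)³ ∣ Q_{a,b}` iff `(b-a)²(2a+3b) = 0`;
* `extreme_member`: with `a < 0`, `a < b` this forces `a = -√6`, `b = 2√6/3` — the extreme member.
-/

namespace Summit.AnomalousDissipation.AnomalousDissipation.Theorems

open Polynomial

/-- The cubic-family profile with contacts `a < b` as a real polynomial. -/
noncomputable def cubicFamily (a b : ℝ) : Polynomial ℝ :=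
  C (-1/60 : ℝ) * (X - C a) ^ 2 * (X - C b) ^ 2 * (X + C (2 * a + 2 * b))

/-- Pointwise form of the cubic-family profile. -/
theorem cubicFamily_eval (a b s : ℝ) :
    (cubicFamily a b).eval s = -(s - a) ^ 2 * (s - b) ^ 2 * (s + 2 * a + 2 * b) / 60 := by
  simp [cubicFamily]
  ring

/-- Normal form on the family ellipse `3a² + 4ab + 3b² = 10`: the profile is
`-s⁵/60 + s³/6 + γ s² + β s + α`, hence its third derivative is `1 - s²`. -/
theorem cubicFamily_normalForm (a b s : ℝ) (hfam : 3 * a ^ 2 + 4 * a * b + 3 * b ^ 2 = 10) :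
    -(s - a) ^ 2 * (s - b) ^ 2 * (s + 2 * a + 2 * b) / 60
      = -s ^ 5 / 60 + s ^ 3 / 6 - (a + b) * (a ^ 2 + 3 * a * b + b ^ 2) / 30 * s ^ 2
        - a * b * (a * b - 4 * (a + b) ^ 2) / 60 * s - (a + b) * a ^ 2 * b ^ 2 / 30 := by
  linear_combination (s ^ 3 / 60) * hfam

/-- A zero of multiplicity three at the downstream contact `b` (a `C²` contact) holds iff
`(b - a)² (2a + 3b) = 0`. -/
theorem cubicFamily_tripleRoot_iff (a b : ℝ) :
    (X - C b) ^ 3 ∣ cubicFamily a b ↔ (b - a) ^ 2 * (2 * a + 3 * b) = 0 := by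
  have hfac : cubicFamily a b
      = (X - C b) ^ 2 * (C (-1/60 : ℝ) * (X - C a) ^ 2 * (X + C (2 * a + 2 * b))) := by
    unfold cubicFamily; ring
  have hne : (X - C b) ^ 2 ≠ 0 := pow_ne_zero 2 (X_sub_C_ne_zero b)
  rw [hfac, pow_succ, mul_dvd_mul_iff_left hne, dvd_iff_isRoot, IsRoot.def]
  simp only [eval_mul, eval_C, eval_pow, eval_sub, eval_X, eval_add]
  constructor
  · intro h; nlinarith [h]
  · intro h; nlinarith [h]

/-- **The extreme member.** On the cubic family (`a < 0 < …`, `a < b`, ellipse relation), a `C²`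
downstream contact forces `a = -√6` and `b = 2√6/3`. -/
theorem extreme_member (a b : ℝ) (ha : a < 0) (hab : a < b)
    (hfam : 3 * a ^ 2 + 4 * a * b + 3 * b ^ 2 = 10) (hC2 : (b - a) ^ 2 * (2 * a + 3 * b) = 0) :
    a = -Real.sqrt 6 ∧ b = 2 * Real.sqrt 6 / 3 := by
  have hba : (b - a) ^ 2 ≠ 0 := by positivity
  have hlin : 2 * a + 3 * b = 0 := by
    rcases mul_eq_zero.mp hC2 with h | h
    · exact absurd h hba
    · exact h
  have hb : b = -(2 * a) / 3 := by linarith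
  have ha2 : a ^ 2 = 6 := by
    rw [hb] at hfam; nlinarith [hfam]
  have h6 : Real.sqrt 6 ^ 2 = 6 := Real.sq_sqrt (by norm_num)
  have hs : 0 < Real.sqrt 6 := Real.sqrt_pos.mpr (by norm_num)
  have hprod : (a + Real.sqrt 6) * (a - Real.sqrt 6) = 0 := by nlinarith [ha2, h6]
  have ha' : a = -Real.sqrt 6 := by
    rcases mul_eq_zero.mp hprod with h | h
    · linarith
    · linarith
  refine ⟨ha', ?_⟩
  rw [hb, ha']; ring

/-- Conversely the extreme member lies on the family ellipse and has the `C²` contact. -/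
theorem extreme_member_onFamily :
    3 * (-Real.sqrt 6) ^ 2 + 4 * (-Real.sqrt 6) * (2 * Real.sqrt 6 / 3)
        + 3 * (2 * Real.sqrt 6 / 3) ^ 2 = 10
      ∧ (2 * Real.sqrt 6 / 3 - -Real.sqrt 6) ^ 2 * (2 * -Real.sqrt 6 + 3 * (2 * Real.sqrt 6 / 3)) = 0 := by
  have h6 : Real.sqrt 6 ^ 2 = 6 := Real.sq_sqrt (by norm_num)
  constructor
  · nlinarith [h6]
  · ring

end Summit.AnomalousDissipation.AnomalousDissipation.Theorems
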